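import Summits.AtomisticToContinuum.BoseEinsteinCondensation.Theorems.BECConjugateDominationInfraredMinimumUncertaintyTiltReflection
import Summits.AtomisticToContinuum.BoseEinsteinCondensation.Theorems.BECConjugateDominationInfraredMinimumUncertaintyStubTiltedGeneratorIdentity

/-!
# Route `BECConjugateDomination`, crux `InfraredMinimumUncertainty` (stmt-AtomisticToContinuum-11784),
# line `tilted-coherence-work-variance`: the crux REDUCED to the single open stub (kernel-checked)

Supports (does not close) stmt-AtomisticToContinuum-11784.  With the registered stubs S1
`stub_tiltedLevyIdentity` (p119407: the thermodynamic-integration identity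
`ν_m = −2∫₀¹ min(t,1−t)·V̂_t(m) dt` + continuity) and S2 `stub_tiltedGeneratorIdentity` (p119409: every
tilted state is an exact ground state — the weak generator identity `TiltedGeneratorIdentityAt`) and the
tilt reflection `Π_{1−t} = Π_t` (`…TiltReflection.lean`) LANDED, the line's composition is sorry-free up to
ONE statement, the lead's reshape-r2 stub S34:

* `TiltedUncertaintyHalfTilts` (a statement, not a fact; = registered stub `stub_tiltedUncertaintyHalfTilts`
  of the skeleton `Cruxes/InfraredMinimumUncertainty/Lines/tilted_coherence_work_variance.lean`): for smooth-class
  `v`, `∃ C ≥ 0, ρ₀ > 0` such that for `0 < ρ < ρ₀`, eventually in `N`, for every positive minimiser with the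
  generator identity, every `m ≠ 0` and every tilt `t ∈ [0,½]`: `Π_t(m) ≤ C`
  (`Π_t(m) = tiltedProduct = −N·S_m·Re ĉ_m[r ↦ Var_{μ_t^{(r)}}(δU_r)]/2`; BEC-strength, conceded);
* `tiltedMinimumUncertainty_of_halfTilts : TiltedUncertaintyHalfTilts → TiltedMinimumUncertainty`
  (S2 discharges the generator-identity hypothesis, the reflection covers `t ∈ [½,1]`);
* `infraredMinimumUncertaintyNamed_of_tilted : TiltedMinimumUncertainty → InfraredMinimumUncertaintyNamed`
  (S1: `N·ν_m·S_m = ∫₀¹ 4min(t,1−t)·Π_t(m) dt ≤ 2C`);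
* `imu_of_tiltedMinimumUncertainty : TiltedMinimumUncertainty → InfraredMinimumUncertainty` (the line's
  TRANSFER certificate `C⁺ ⇒ IMU`; registered sub-goal) and
  `imu_of_tiltedUncertaintyHalfTilts : TiltedUncertaintyHalfTilts → InfraredMinimumUncertainty`
  (the crux CLOSED MODULO S34; registered sub-goal).

The converse directions are not claimed: `C⁺` is the crux's strict `t`-refinement (IMU is its
`4min(t,1−t)dt`-average; they differ by the higher work-cumulant profiles — lead's NOTES in the crux folder).
-/

noncomputable section

open MeasureTheory Filter Set
open scoped ENNReal NNReal Topology BigOperators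

namespace Summit.AtomisticToContinuum.BoseEinsteinCondensation.Theorems.BECConjugateDomination

open Literature.MathematicalPhysics.QuantumManyBody.BoseGas
open Summit.AtomisticToContinuum.BoseEinsteinCondensation.Theses.BECConjugateDomination
  (InfraredMinimumUncertainty)
open Summit.AtomisticToContinuum.BoseEinsteinCondensation.Cruxes.InfraredMinimumUncertainty.FisherGaussianDensityMode
  (InSmoothClass IsPositiveMinimiser coherence levyWeight structureFactor CruxFrame
    InfraredMinimumUncertaintyNamed infraredMinimumUncertainty_iff_named mul_structureFactor_nonneg)
open Summit.AtomisticToContinuum.BoseEinsteinCondensation.Cruxes.InfraredMinimumUncertainty.TiltedCoherenceWorkVariance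

/-! ## The single open statement of the line (reshape r2) -/

/-- **`TiltedUncertaintyHalfTilts` — the transfer `C⁺` on the half range `t ∈ [0,½]`, given the generator
identity** (a statement, not a fact; the registered stub `stub_tiltedUncertaintyHalfTilts` of the line,
merging the planner's S3 `stub_tiltStability` and S4 `stub_bridgeVarianceCeiling`; BEC-strength, conceded):
for smooth-class `v` there are `C ≥ 0`, `ρ₀ > 0` such that for `0 < ρ < ρ₀`, eventually in `N = n+1`, for
every positive minimiser `Ψ` on the torus of side `(N/ρ)^{1/3}` satisfying `TiltedGeneratorIdentityAt v Ψ`,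
every `m ≠ 0` and every tilt `t ∈ [0,½]`: `Π_t(m) ≤ C`. -/
def TiltedUncertaintyHalfTilts : Prop :=
  ∀ v : ℝ → ℝ≥0∞, InSmoothClass v → ∃ C : ℝ, 0 ≤ C ∧ ∃ ρ₀ : ℝ, 0 < ρ₀ ∧
    ∀ ρ : ℝ, 0 < ρ → ρ < ρ₀ → ∀ᶠ n : ℕ in atTop,
      ∀ Ψ : PeriodicTrialState (n + 1) (sideLength ρ (n + 1)),
        IsPositiveMinimiser v Ψ → TiltedGeneratorIdentityAt v Ψ →
          ∀ m : Fin 3 → ℤ, m ≠ 0 → ∀ t ∈ Set.Icc (0 : ℝ) (1 / 2),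
            tiltedProduct n (sideLength ρ (n + 1)) Ψ t m ≤ C

/-! ## S2 ∧ S34 ∧ reflection ⇒ `C⁺` -/

/-- **`TiltedUncertaintyHalfTilts → TiltedMinimumUncertainty`** (all `t ∈ [0,1]`): the landed S2
`stub_tiltedGeneratorIdentity` supplies the generator identity, a tilt `t > ½` is sent to `1 − t < ½` by the
landed `tiltedProduct_one_sub` (`Π_{1−t} = Π_t`). -/
theorem tiltedMinimumUncertainty_of_halfTilts (h34 : TiltedUncertaintyHalfTilts) :
    TiltedMinimumUncertainty := by
  intro v hv
  obtain ⟨C, hC, ρ₀, hρ₀, h⟩ := h34 v hv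
  refine ⟨C, hC, ρ₀, hρ₀, fun ρ hρ hρρ₀ => ?_⟩
  filter_upwards [h ρ hρ hρρ₀] with n hn
  intro Ψ hmin m hm t ht
  have hL : 0 < sideLength ρ (n + 1) := by
    unfold sideLength
    exact Real.rpow_pos_of_pos (by positivity) _
  have hgen : TiltedGeneratorIdentityAt v Ψ :=
    stub_tiltedGeneratorIdentity v hv n (sideLength ρ (n + 1)) hL Ψ hmin
  rcases le_or_gt t (1 / 2) with hle | hgt
  · exact hn Ψ hmin hgen m hm t ⟨ht.1, hle⟩
  · have hs : 1 - t ∈ Set.Icc (0 : ℝ) (1 / 2) := ⟨by linarith [ht.2], by linarith⟩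
    have hrefl : tiltedProduct n (sideLength ρ (n + 1)) Ψ t m =
        tiltedProduct n (sideLength ρ (n + 1)) Ψ (1 - t) m := by
      have := tiltedProduct_one_sub Ψ hL (1 - t) m
      rw [sub_sub_cancel] at this
      exact this
    rw [hrefl]
    exact hn Ψ hmin hgen m hm (1 - t) hs

/-! ## `C⁺ ∧ S1 ⇒` the crux -/

/-- **`C⁺ ⇒` the crux over the named objects**: the landed S1 `stub_tiltedLevyIdentity` (b) turns
`N·ν_m·S_m` into `∫₀¹ 4min(t,1−t)·Π_t(m) dt` (`N S_m` pulled inside), S1 (c) makes the integrand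
integrable, and `0 ≤ 4min(t,1−t) ≤ 2` on `[0,1]` with `Π_t ≤ C` gives `N·ν_m·S_m ≤ 2C`. -/
theorem infraredMinimumUncertaintyNamed_of_tilted (hT : TiltedMinimumUncertainty) :
    InfraredMinimumUncertaintyNamed := by
  intro v hv₁ hv₂ hv₃ hv₄
  have hv : InSmoothClass v := ⟨hv₁, hv₂, hv₃, hv₄⟩
  obtain ⟨K, hK, ρ₀, hρ₀, hB⟩ := hT v hv
  refine ⟨2 * K, by positivity, ρ₀, hρ₀, fun ρ hρ hρρ₀ => ?_⟩
  filter_upwards [hB ρ hρ hρρ₀] with n hn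
  intro Ψ hE hfin hreal hpos m hm
  have hL : 0 < sideLength ρ (n + 1) := by
    unfold sideLength
    exact Real.rpow_pos_of_pos (by positivity) _
  have hbound : ∀ t ∈ Set.Icc (0 : ℝ) 1, tiltedProduct n (sideLength ρ (n + 1)) Ψ t m ≤ K :=
    hn Ψ ⟨hE, hfin, hreal, hpos⟩ m hm
  -- S1: the crux's Lévy weight as a tilt average, with continuity of the profile coefficient
  obtain ⟨hlevy, hcont⟩ := (stub_tiltedLevyIdentity n (sideLength ρ (n + 1)) hL Ψ hpos).2 m
  -- integrability of the tilt integrand on `[0,1]` (continuity, S1 (c))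
  have hI : IntervalIntegrable
      (fun t : ℝ => min t (1 - t) * tiltVarCoeff n (sideLength ρ (n + 1)) Ψ t m) volume 0 1 := by
    apply ContinuousOn.intervalIntegrable
    rw [Set.uIcc_of_le zero_le_one]
    have hc : Continuous fun t : ℝ => min t (1 - t) :=
      continuous_id.min (continuous_const.sub continuous_id)
    exact hc.continuousOn.mul hcont
  -- the crux's product IS the weighted tilt average (S1 (b))
  have key : ((n : ℝ) + 1) * levyWeight n (sideLength ρ (n + 1)) Ψ m *
        structureFactor n (sideLength ρ (n + 1)) Ψ m =
      ∫ t in (0 : ℝ)..1,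
        (-2 * (((n : ℝ) + 1) * structureFactor n (sideLength ρ (n + 1)) Ψ m)) *
          (min t (1 - t) * tiltVarCoeff n (sideLength ρ (n + 1)) Ψ t m) := by
    rw [intervalIntegral.integral_const_mul, hlevy]
    ring
  rw [key]
  calc ∫ t in (0 : ℝ)..1,
        (-2 * (((n : ℝ) + 1) * structureFactor n (sideLength ρ (n + 1)) Ψ m)) *
          (min t (1 - t) * tiltVarCoeff n (sideLength ρ (n + 1)) Ψ t m)
      ≤ ∫ t in (0 : ℝ)..1, 2 * K := by
        refine intervalIntegral.integral_mono_on zero_le_one (hI.const_mul _)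
          intervalIntegrable_const fun t ht => ?_
        have hm0 : 0 ≤ min t (1 - t) := le_min ht.1 (by linarith [ht.2])
        have hm1 : min t (1 - t) ≤ 1 / 2 := by
          rcases le_total t (1 / 2) with h | h
          · exact (min_le_left _ _).trans h
          · exact (min_le_right _ _).trans (by linarith)
        have hP : tiltedProduct n (sideLength ρ (n + 1)) Ψ t m ≤ K := hbound t ht
        have hrw : (-2 * (((n : ℝ) + 1) * structureFactor n (sideLength ρ (n + 1)) Ψ m)) *
              (min t (1 - t) * tiltVarCoeff n (sideLength ρ (n + 1)) Ψ t m) =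
            4 * min t (1 - t) * tiltedProduct n (sideLength ρ (n + 1)) Ψ t m := by
          unfold tiltedProduct
          ring
        rw [hrw]
        nlinarith [mul_nonneg hm0 (sub_nonneg.2 hP), mul_nonneg (sub_nonneg.2 hm1) hK]
    _ = 2 * K := by simp

/-- **The TRANSFER certificate of the line (registered sub-goal): `C⁺ ⇒ IMU`.**
`TiltedMinimumUncertainty → InfraredMinimumUncertainty` for route `BECConjugateDomination`
(stmt-AtomisticToContinuum-11784), through the named restatement (`infraredMinimumUncertainty_iff_named`,
`Iff.rfl` in the tree). -/
theorem imu_of_tiltedMinimumUncertainty : TiltedMinimumUncertainty → InfraredMinimumUncertainty :=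
  fun hT => infraredMinimumUncertainty_iff_named.mp (infraredMinimumUncertaintyNamed_of_tilted hT)

/-- **The crux CLOSED MODULO S34 (registered sub-goal):**
`TiltedUncertaintyHalfTilts → InfraredMinimumUncertainty` — with S1, S2 and the tilt reflection landed, the
route's crux `InfraredMinimumUncertainty` (stmt-AtomisticToContinuum-11784) follows from the single open
statement of the line, constants `C_IMU = 2C`, `ρ₀` of S34. -/
theorem imu_of_tiltedUncertaintyHalfTilts : TiltedUncertaintyHalfTilts → InfraredMinimumUncertainty :=
  fun h34 => imu_of_tiltedMinimumUncertainty (tiltedMinimumUncertainty_of_halfTilts h34)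

end Summit.AtomisticToContinuum.BoseEinsteinCondensation.Theorems.BECConjugateDomination

end
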